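import Summits.CriticalPhenomena.CardyFormulaZ2.Theses.CardyUSTContinuation

/-!
# Route CardyUSTContinuation — support item `CruxesGiveTarget`

Glue (frame: cruxes ⇒ thesis X): the two interval cruxes `SmallFugacityLimit` (X_S) and
`UniformAnalyticExtension` (X_A) give the route target `Target` (X = X_S ∧ X_A).

`Target` is literally the conjunction of the bodies of `SmallFugacityLimit` and
`UniformAnalyticExtension` with the shared `let`s (Z, U, uJ) inlined, so after unfolding the
three definitions the statement is `A → B → A ∧ B` up to ζ/β-reduction, closed by `And.intro`.
Pure logic; closes item stmt-CriticalPhenomena-14172.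
-/

namespace Summit.CriticalPhenomena.CardyFormulaZ2.Theorems

open Summit.CriticalPhenomena.CardyFormulaZ2.Theses.CardyUSTContinuation

/-- The two interval cruxes give the route target: `SmallFugacityLimit → UniformAnalyticExtension →
Target`. Since `Target` unfolds (definitionally, the shared `let`s being inlined) to the
conjunction of the bodies of `SmallFugacityLimit` and `UniformAnalyticExtension`, the proof is
`And.intro`. Closes item stmt-CriticalPhenomena-14172 of route CardyUSTContinuation. -/
theorem cruxesGiveTarget_proof :
    Summit.CriticalPhenomena.CardyFormulaZ2.Theses.CardyUSTContinuation.CruxesGiveTarget := by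
  unfold CruxesGiveTarget
  intro hS hA
  unfold Target
  unfold SmallFugacityLimit at hS
  unfold UniformAnalyticExtension at hA
  exact ⟨hS, hA⟩

end Summit.CriticalPhenomena.CardyFormulaZ2.Theorems
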